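import Summits.ValiantsHypothesis.ValiantsHypothesis.Theorems.MonotoneRestorationOrbitRestorationQPAltFixBlocks
import HarnessLib

/-!
# Small `Sym_n`-modules have alternating-fixed vectors, II: joint eigenspaces of commuting 3-cycles

Route MonotoneRestoration, crux `OrbitRestorationQP` (stmt-ValiantsHypothesis-18293), line `depth-three-rung`,
stub A_∞ `stub_sigmaPiSigmaValue`, ΣΛΣ sub-rung (proof of the hypothesis `hKey` of
`…DerivativeTowerWaringAlt.lean`).  See `…AltFixBlocks.lean` for the overview.

This file (definition-free; a primitive cube root of unity `ω` and a commuting family `γ` of elements of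
order `3` are parameters): for a representation `ρ : Perm (Fin n) →* End ℂ V` on a finite-dimensional
space, the joint eigenspaces `⨅ i, eigenspace (ρ (γ i)) (ω ^ (ε i).val)` indexed by characters
`ε : Fin m → ZMod 3` are independent (`iSupIndep_joint`), so at most `finrank V` of them are nonzero
(`card_filter_joint_ne_bot_le`); every nonzero `γ`-stable subspace meets one of them (`exists_joint_inf_ne_bot`);
conjugation data transports nonzero joint eigenspaces along block permutations and flips
(`joint_ne_bot_perm`, `joint_ne_bot_flip`); and the KEY STEP `fixed_of_maxSupport`: for a character `ε₀`
of maximal support `N` among the nonzero joint eigenspaces, every `γ i` with `i ∉ N` acts trivially on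
the partial eigenspace cut out by the blocks in `N`.  Everything is proved. [folklore]
-/

noncomputable section

open scoped Classical

-- `Summit.ValiantsHypothesis.ValiantsHypothesis.…` is the tree's single-conjunct layout (Sub = Summit).
set_option linter.dupNamespace false

namespace Summit.ValiantsHypothesis.ValiantsHypothesis.Theorems

namespace AltFix

open Equiv Equiv.Perm Module Module.End

variable {n m : ℕ} {V : Type} [AddCommGroup V] [Module ℂ V]
  (ρ : Perm (Fin n) →* Module.End ℂ V) (γ : Fin m → Perm (Fin n)) {ω : ℂ}

/-! ### Joint eigenspaces -/

/-- Membership in a joint eigenspace. [folklore] -/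
theorem mem_joint_iff (μ : Fin m → ℂ) (v : V) :
    v ∈ (⨅ i, eigenspace (ρ (γ i)) (μ i)) ↔ ∀ i, ρ (γ i) v = μ i • v := by
  simp only [Submodule.mem_iInf, mem_eigenspace_iff]

/-- `ε ↦ (i ↦ ω ^ (ε i).val)` is injective for a primitive cube root `ω`. [folklore] -/
theorem charVal_injective (hω : IsPrimitiveRoot ω 3) :
    Function.Injective fun (ε : Fin m → ZMod 3) (i : Fin m) => ω ^ (ε i).val := by
  intro ε ε' h
  funext i
  have hi := congrFun h i
  exact ZMod.val_injective 3 (hω.pow_inj (ZMod.val_lt _) (ZMod.val_lt _) hi)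

/-- **The joint eigenspaces of a commuting family are independent.** [folklore] -/
theorem iSupIndep_joint (hω : IsPrimitiveRoot ω 3) (hγc : ∀ i i', Commute (γ i) (γ i')) :
    iSupIndep fun ε : Fin m → ZMod 3 => ⨅ i, eigenspace (ρ (γ i)) (ω ^ (ε i).val) := by
  have h := Module.End.independent_iInf_maxGenEigenspace_of_forall_mapsTo (fun i => ρ (γ i))
    fun i j φ => mapsTo_maxGenEigenspace_of_comm ((hγc j i).map ρ) φ
  have h2 := h.comp (charVal_injective (m := m) hω)
  refine h2.mono fun ε => ?_
  exact iInf_mono fun i => eigenspace_le_maxGenEigenspace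

/-- **At most `finrank V` joint eigenspaces are nonzero.** [folklore] -/
theorem card_filter_joint_ne_bot_le [FiniteDimensional ℂ V] (hω : IsPrimitiveRoot ω 3)
    (hγc : ∀ i i', Commute (γ i) (γ i')) :
    (Finset.univ.filter fun ε : Fin m → ZMod 3 =>
      (⨅ i, eigenspace (ρ (γ i)) (ω ^ (ε i).val)) ≠ ⊥).card ≤ finrank ℂ V := by
  rw [← Fintype.card_subtype]
  exact (iSupIndep_joint ρ γ hω hγc).subtype_ne_bot_le_finrank

/-- `ρ (γ i)` cubes to the identity when `γ i ^ 3 = 1`. [folklore] -/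
theorem act_cube (hγ3 : ∀ i, γ i ^ 3 = 1) (i : Fin m) (v : V) : ρ (γ i) (ρ (γ i) (ρ (γ i) v)) = v := by
  have h : ρ (γ i) * (ρ (γ i) * ρ (γ i)) = 1 := by
    rw [← map_mul, ← map_mul, ← pow_three, hγ3, map_one]
  have := congrArg (fun f : Module.End ℂ V => f v) h
  simpa only [Module.End.mul_apply, Module.End.one_apply] using this

/-- **Every nonzero `γ`-stable subspace meets a joint eigenspace.** [folklore] -/
theorem exists_joint_inf_ne_bot [FiniteDimensional ℂ V] (hω : IsPrimitiveRoot ω 3) (hγc : ∀ i i', Commute (γ i) (γ i'))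
    (hγ3 : ∀ i, γ i ^ 3 = 1) (Y : Submodule ℂ V) (hY : Y ≠ ⊥)
    (hst : ∀ i, ∀ y ∈ Y, ρ (γ i) y ∈ Y) :
    ∃ ε : Fin m → ZMod 3, (⨅ i, eigenspace (ρ (γ i)) (ω ^ (ε i).val)) ⊓ Y ≠ ⊥ := by
  -- successive refinement: scalar action of `γ i` for `i < k`
  have key : ∀ k, k ≤ m → ∃ Y' : Submodule ℂ V, Y' ≤ Y ∧ Y' ≠ ⊥ ∧ (∀ i, ∀ y ∈ Y', ρ (γ i) y ∈ Y') ∧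
      ∃ μ : Fin m → ℂ, ∀ i : Fin m, (i : ℕ) < k → ∀ y ∈ Y', ρ (γ i) y = μ i • y := by
    intro k
    induction k with
    | zero => exact fun _ => ⟨Y, le_rfl, hY, hst, fun _ => 0, fun i hi => (Nat.not_lt_zero _ hi).elim⟩
    | succ k ih =>
      intro hk
      obtain ⟨Y', hY'Y, hY'ne, hY'st, μ, hμ⟩ := ih (Nat.le_of_succ_le hk)
      let i₀ : Fin m := ⟨k, hk⟩
      haveI : Nontrivial Y' := Submodule.nontrivial_iff_ne_bot.mpr hY'ne
      let f : Module.End ℂ Y' := (ρ (γ i₀)).restrict (hY'st i₀)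
      obtain ⟨c, hc⟩ := Module.End.exists_eigenvalue f
      obtain ⟨y, hy⟩ := hc.exists_hasEigenvector
      have hfy : ρ (γ i₀) (y : V) = c • (y : V) := by
        have := congrArg Subtype.val hy.apply_eq_smul
        simpa [f, LinearMap.coe_restrict_apply] using this
      refine ⟨Y' ⊓ eigenspace (ρ (γ i₀)) c, inf_le_left.trans hY'Y, ?_, ?_, Function.update μ i₀ c, ?_⟩
      · rw [Submodule.ne_bot_iff]
        refine ⟨y, ⟨y.2, mem_eigenspace_iff.mpr hfy⟩, fun h => hy.2 (Subtype.ext h)⟩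
      · intro i z hz
        refine ⟨hY'st i z hz.1, mem_eigenspace_iff.mpr ?_⟩
        have hc' := ((hγc i₀ i).map ρ)
        rw [← Module.End.mul_apply, hc'.eq, Module.End.mul_apply, mem_eigenspace_iff.mp hz.2, map_smul]
      · intro i hi z hz
        by_cases h : i = i₀
        · subst h; rw [Function.update_self]; exact mem_eigenspace_iff.mp hz.2
        · rw [Function.update_of_ne h]
          have : (i : ℕ) < k := by
            have h1 : (i : ℕ) ≠ k := fun e => h (Fin.ext e)
            omega
          exact hμ i this z hz.1
  obtain ⟨Y', hY'Y, hY'ne, -, μ, hμ⟩ := key m le_rfl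
  obtain ⟨y, hyY', hy0⟩ := (Submodule.ne_bot_iff _).mp hY'ne
  -- the eigenvalues are cube roots of unity
  have hμ3 : ∀ i, μ i ^ 3 = 1 := by
    intro i
    have hy1 : ρ (γ i) y = μ i • y := hμ i i.isLt y hyY'
    have h1 := act_cube ρ γ hγ3 i y
    simp only [hy1, map_smul, smul_smul] at h1
    have h2 : (μ i ^ 3 - 1) • y = 0 := by rw [sub_smul, one_smul, pow_three', h1, sub_self]
    rcases smul_eq_zero.mp h2 with h | h
    · exact sub_eq_zero.mp h
    · exact absurd h hy0
  have hex : ∀ i, ∃ k : ℕ, k < 3 ∧ ω ^ k = μ i := fun i => by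
    obtain ⟨k, hk, e⟩ := hω.eq_pow_of_pow_eq_one (hμ3 i)
    exact ⟨k, hk, e⟩
  choose k hk hkμ using hex
  refine ⟨fun i => (k i : ZMod 3), ?_⟩
  rw [Submodule.ne_bot_iff]
  refine ⟨y, ⟨(mem_joint_iff ρ γ _ y).mpr fun i => ?_, hY'Y hyY'⟩, hy0⟩
  rw [ZMod.val_natCast, Nat.mod_eq_of_lt (hk i), hkμ, hμ i i.isLt y hyY']

/-- A nonzero joint eigenspace stays nonzero after acting by `g` with `g γ_i g⁻¹ = γ_{β i}`: the character
moves to `ε ∘ β⁻¹`. [folklore] -/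
theorem joint_ne_bot_perm {g : Perm (Fin n)} {β : Perm (Fin m)} (hg : ∀ i, g * γ i * g⁻¹ = γ (β i))
    {ε : Fin m → ZMod 3} (hε : (⨅ i, eigenspace (ρ (γ i)) (ω ^ (ε i).val)) ≠ ⊥) :
    (⨅ i, eigenspace (ρ (γ i)) (ω ^ (ε (β.symm i)).val)) ≠ ⊥ := by
  obtain ⟨v, hv, hv0⟩ := (Submodule.ne_bot_iff _).mp hε
  rw [Submodule.ne_bot_iff]
  refine ⟨ρ g v, (mem_joint_iff ρ γ _ _).mpr fun j => ?_, fun h => hv0 ?_⟩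
  · have h1 : γ j * g = g * γ (β.symm j) := by
      have := hg (β.symm j)
      rw [Equiv.apply_symm_apply] at this
      exact (mul_inv_eq_iff_eq_mul.mp this).symm
    rw [← Module.End.mul_apply, ← map_mul, h1, map_mul, Module.End.mul_apply,
      (mem_joint_iff ρ γ _ _).mp hv, map_smul]
  · have : ρ g⁻¹ (ρ g v) = v := by
      rw [← Module.End.mul_apply, ← map_mul, inv_mul_cancel, map_one, Module.End.one_apply]
    rw [← this, h, map_zero]

/-- A nonzero joint eigenspace stays nonzero after acting by the flip `t` of block `i`
(`t γ_i t⁻¹ = γ_i⁻¹`, `t⁻¹ = t`, `t` commuting with the other `γ_{i'}`): the character is negated at `i`.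
[folklore] -/
theorem joint_ne_bot_flip (hω : IsPrimitiveRoot ω 3) {t : Perm (Fin n)} {i : Fin m}
    (ht : t * γ i * t⁻¹ = (γ i)⁻¹) (htt : t⁻¹ = t) (htc : ∀ i', i' ≠ i → Commute t (γ i'))
    {ε : Fin m → ZMod 3} (hε : (⨅ i, eigenspace (ρ (γ i)) (ω ^ (ε i).val)) ≠ ⊥) :
    (⨅ i', eigenspace (ρ (γ i')) (ω ^ (Function.update ε i (-ε i) i').val)) ≠ ⊥ := by
  obtain ⟨v, hv, hv0⟩ := (Submodule.ne_bot_iff _).mp hε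
  have hv' := (mem_joint_iff ρ γ _ _).mp hv
  rw [Submodule.ne_bot_iff]
  refine ⟨ρ t v, (mem_joint_iff ρ γ _ _).mpr fun j => ?_, fun h => hv0 ?_⟩
  · by_cases hj : j = i
    · subst hj
      rw [Function.update_self]
      have htt2 : t * t = 1 := by
        calc t * t = t⁻¹ * t := by rw [htt]
          _ = 1 := inv_mul_cancel t
      have h1 : γ j * t = t * (γ j)⁻¹ := by
        rw [← ht, htt]
        simp only [← mul_assoc, htt2, one_mul]
      -- the inverse acts by the inverse eigenvalue
      have hωu : ω ^ (ε j).val * ω ^ (-ε j).val = 1 := by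
        rw [← pow_add, ← Nat.mod_add_div ((ε j).val + (-ε j).val) 3, pow_add, pow_mul, hω.pow_eq_one,
          one_pow, mul_one, ← ZMod.val_add, add_neg_cancel, ZMod.val_zero, pow_zero]
      have h2 : ρ (γ j)⁻¹ v = ω ^ (-ε j).val • v := by
        have h3 : ρ (γ j)⁻¹ (ρ (γ j) v) = v := by
          rw [← Module.End.mul_apply, ← map_mul, inv_mul_cancel, map_one, Module.End.one_apply]
        rw [hv' j, map_smul] at h3
        calc ρ (γ j)⁻¹ v = (ω ^ (ε j).val * ω ^ (-ε j).val) • ρ (γ j)⁻¹ v := by rw [hωu, one_smul]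
          _ = ω ^ (-ε j).val • (ω ^ (ε j).val • ρ (γ j)⁻¹ v) := by rw [mul_comm, mul_smul]
          _ = ω ^ (-ε j).val • v := by rw [h3]
      rw [← Module.End.mul_apply, ← map_mul, h1, map_mul, Module.End.mul_apply, h2, map_smul]
    · rw [Function.update_of_ne hj, ← Module.End.mul_apply, ← map_mul, ← (htc j hj).eq, map_mul,
        Module.End.mul_apply, hv' j, map_smul]
  · have : ρ t⁻¹ (ρ t v) = v := by
      rw [← Module.End.mul_apply, ← map_mul, inv_mul_cancel, map_one, Module.End.one_apply]
    rw [← this, h, map_zero]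

/-! ### The key step: maximal support forces trivial action off the support -/

/-- Eigenspaces of `ρ (γ j)` are stable under the commuting `ρ (γ k)`. [folklore] -/
theorem act_mem_eigenspace (hγc : ∀ i i', Commute (γ i) (γ i')) (j k : Fin m) (c : ℂ) {v : V}
    (hv : v ∈ eigenspace (ρ (γ j)) c) : ρ (γ k) v ∈ eigenspace (ρ (γ j)) c := by
  rw [mem_eigenspace_iff] at hv ⊢
  rw [← Module.End.mul_apply, ((hγc j k).map ρ).eq, Module.End.mul_apply, hv, map_smul]

/-- **KEY STEP.**  Let `ε₀` be a character whose support `N` has maximal size among the characters with a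
nonzero joint eigenspace.  Then every `γ i` with `i ∉ N` acts trivially on every vector on which the `γ j`,
`j ∈ N`, act by the character `ε₀` (the partial eigenspace of the blocks in `N`).  Proof: the partial
eigenspace is `γ`-stable; if `γ i` were not the identity on it, the `γ`-stable subspace where moreover
`1 + γ i + γ i² = 0` would be nonzero, hence contain a joint eigenvector, whose character extends `ε₀|_N`
and is nontrivial at `i` — a larger support. [folklore] -/
theorem fixed_of_maxSupport [FiniteDimensional ℂ V] (hω : IsPrimitiveRoot ω 3)
    (hγc : ∀ i i', Commute (γ i) (γ i')) (hγ3 : ∀ i, γ i ^ 3 = 1)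
    (ε₀ : Fin m → ZMod 3) (N : Finset (Fin m)) (hN : ∀ i, i ∈ N ↔ ε₀ i ≠ 0)
    (hmax : ∀ ε : Fin m → ZMod 3, (⨅ i, eigenspace (ρ (γ i)) (ω ^ (ε i).val)) ≠ ⊥ →
      (Finset.univ.filter fun i => ε i ≠ 0).card ≤ N.card)
    {i : Fin m} (hi : i ∉ N) {z : V} (hz : ∀ j ∈ N, ρ (γ j) z = ω ^ (ε₀ j).val • z) :
    ρ (γ i) z = z := by
  -- the partial eigenspace of the blocks in `N`
  let ZN : Submodule ℂ V := ⨅ j, ⨅ (_ : j ∈ N), eigenspace (ρ (γ j)) (ω ^ (ε₀ j).val)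
  have memZN : ∀ v, v ∈ ZN ↔ ∀ j ∈ N, ρ (γ j) v = ω ^ (ε₀ j).val • v := by
    intro v; simp only [ZN, Submodule.mem_iInf, mem_eigenspace_iff]
  have stZN : ∀ k, ∀ v ∈ ZN, ρ (γ k) v ∈ ZN := by
    intro k v hv
    simp only [ZN, Submodule.mem_iInf] at hv ⊢
    exact fun j hj => act_mem_eigenspace ρ γ hγc j k _ (hv j hj)
  -- the sub-space where `1 + γ i + γ i²` vanishes
  let f : Module.End ℂ V := ρ (γ i)
  let K : Submodule ℂ V := ZN ⊓ LinearMap.ker ((1 : Module.End ℂ V) + f + f * f)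
  have memK : ∀ v, v ∈ K ↔ v ∈ ZN ∧ v + f v + f (f v) = 0 := by
    intro v
    simp only [K, Submodule.mem_inf, LinearMap.mem_ker, LinearMap.add_apply, Module.End.mul_apply,
      Module.End.one_apply]
  have hfcomm : ∀ k (v : V), f (ρ (γ k) v) = ρ (γ k) (f v) := by
    intro k v
    show ρ (γ i) (ρ (γ k) v) = ρ (γ k) (ρ (γ i) v)
    rw [← Module.End.mul_apply, ((hγc i k).map ρ).eq, Module.End.mul_apply]
  have stK : ∀ k, ∀ v ∈ K, ρ (γ k) v ∈ K := by
    intro k v hv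
    obtain ⟨hv1, hv2⟩ := (memK v).mp hv
    refine (memK _).mpr ⟨stZN k v hv1, ?_⟩
    rw [hfcomm, hfcomm, hfcomm, ← map_add, ← map_add, hv2, map_zero]
  -- `K = ⊥` by maximality of the support
  have hK : K = ⊥ := by
    by_contra hK
    obtain ⟨ε, hε⟩ := exists_joint_inf_ne_bot ρ γ hω hγc hγ3 K hK stK
    obtain ⟨y, ⟨hyJ, hyK⟩, hy0⟩ := (Submodule.ne_bot_iff _).mp hε
    have hyJ' := (mem_joint_iff ρ γ _ _).mp hyJ
    have hsub : insert i N ⊆ Finset.univ.filter (fun j => ε j ≠ 0) := by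
      intro j hj
      simp only [Finset.mem_filter, Finset.mem_univ, true_and]
      rcases Finset.mem_insert.mp hj with rfl | hjN
      · intro h0
        have h1 := ((memK y).mp hyK).2
        have hfy : f y = y := by
          show ρ (γ j) y = y
          rw [hyJ' j, h0, ZMod.val_zero, pow_zero, one_smul]
        rw [hfy, hfy] at h1
        have h3 : (3 : ℂ) • y = 0 := by
          rw [show (3 : ℂ) = 1 + 1 + 1 by norm_num, add_smul, add_smul, one_smul]; exact h1
        rcases smul_eq_zero.mp h3 with h | h
        · norm_num at h
        · exact hy0 h
      · intro h0
        have h1 := ((memZN y).mp ((memK y).mp hyK).1) j hjN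
        rw [hyJ' j] at h1
        have h2 : (ε j).val = (ε₀ j).val :=
          hω.pow_inj (ZMod.val_lt _) (ZMod.val_lt _) (smul_left_injective ℂ hy0 h1)
        exact (hN j).mp hjN ((ZMod.val_injective 3 h2) ▸ h0)
    have hcard := Finset.card_le_card hsub
    rw [Finset.card_insert_of_notMem hi] at hcard
    have := hmax ε fun h => hε (by rw [h, bot_inf_eq])
    omega
  -- conclude: `f z - z ∈ K = ⊥`
  have hzZ : z ∈ ZN := (memZN z).mpr hz
  have hu : f z - z ∈ K := by
    refine (memK _).mpr ⟨Submodule.sub_mem _ (stZN i z hzZ) hzZ, ?_⟩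
    have h3 : f (f (f z)) = z := act_cube ρ γ hγ3 i z
    simp only [map_sub, h3]
    abel
  rw [hK, Submodule.mem_bot, sub_eq_zero] at hu
  exact hu

/-! ### Counting nonzero joint eigenspaces -/

/-- Nonzero elements of `ZMod 3` are not their own negatives. [folklore] -/
theorem neg_ne_self_of_ne_zero : ∀ e : ZMod 3, e ≠ 0 → -e ≠ e := by decide

/-- **Flips: `2 ^ |supp ε₀|` nonzero joint eigenspaces.** [folklore] -/
theorem two_pow_card_support_le (hω : IsPrimitiveRoot ω 3) (b : Fin m → Fin 3 → Fin n)
    (hflip : ∀ i, swap (b i 1) (b i 2) * γ i * (swap (b i 1) (b i 2))⁻¹ = (γ i)⁻¹)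
    (hflipc : ∀ i i', i' ≠ i → Commute (swap (b i 1) (b i 2)) (γ i'))
    (ε₀ : Fin m → ZMod 3) (hε₀ : (⨅ i, eigenspace (ρ (γ i)) (ω ^ (ε₀ i).val)) ≠ ⊥) :
    2 ^ (Finset.univ.filter fun i => ε₀ i ≠ 0).card ≤
      (Finset.univ.filter fun ε : Fin m → ZMod 3 =>
        (⨅ i, eigenspace (ρ (γ i)) (ω ^ (ε i).val)) ≠ ⊥).card := by
  set N := Finset.univ.filter fun i => ε₀ i ≠ 0 with hN
  let fl : Finset (Fin m) → Fin m → ZMod 3 := fun S j => if j ∈ S then -ε₀ j else ε₀ j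
  have hfl : ∀ S : Finset (Fin m), (⨅ i, eigenspace (ρ (γ i)) (ω ^ (fl S i).val)) ≠ ⊥ := by
    intro S
    induction S using Finset.induction_on with
    | empty => simpa [fl] using hε₀
    | insert a S haS ih =>
      have hfun : fl (insert a S) = Function.update (fl S) a (-(fl S a)) := by
        funext j
        by_cases hj : j = a
        · subst hj; simp [fl, haS]
        · simp [fl, Finset.mem_insert, hj]
      rw [hfun]
      exact joint_ne_bot_flip ρ γ hω (hflip a) (swap_inv _ _) (hflipc a) ih
  have hinj : Set.InjOn fl ↑(N.powerset) := by
    intro S hS S' hS' h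
    rw [Finset.coe_powerset] at hS hS'
    have hS1 : S ⊆ N := hS
    have hS2 : S' ⊆ N := hS'
    ext j
    have hj := congrFun h j
    simp only [fl] at hj
    by_cases hjN : j ∈ N
    · have hne : -ε₀ j ≠ ε₀ j := neg_ne_self_of_ne_zero _ (Finset.mem_filter.mp hjN).2
      constructor
      · intro hjS
        by_contra hjS'
        rw [if_pos hjS, if_neg hjS'] at hj
        exact hne hj
      · intro hjS'
        by_contra hjS
        rw [if_neg hjS, if_pos hjS'] at hj
        exact hne hj.symm
    · exact ⟨fun h => absurd (hS1 h) hjN, fun h => absurd (hS2 h) hjN⟩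
  calc 2 ^ N.card = N.powerset.card := (Finset.card_powerset N).symm
    _ ≤ _ := Finset.card_le_card_of_injOn fl (fun S _ => by simp [hfl S]) hinj

/-- **Block permutations: `C(m, |supp ε₀|)` nonzero joint eigenspaces.** [folklore] -/
theorem choose_card_support_le (P : Perm (Fin m) → Perm (Fin n))
    (hP : ∀ β i, P β * γ i * (P β)⁻¹ = γ (β i))
    (ε₀ : Fin m → ZMod 3) (hε₀ : (⨅ i, eigenspace (ρ (γ i)) (ω ^ (ε₀ i).val)) ≠ ⊥) :
    m.choose (Finset.univ.filter fun i => ε₀ i ≠ 0).card ≤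
      (Finset.univ.filter fun ε : Fin m → ZMod 3 =>
        (⨅ i, eigenspace (ρ (γ i)) (ω ^ (ε i).val)) ≠ ⊥).card := by
  set N := Finset.univ.filter fun i => ε₀ i ≠ 0 with hN
  -- a permutation carrying `N` onto any `N'` of the same size
  have hex : ∀ N' : Finset (Fin m), N'.card = N.card → ∃ β : Perm (Fin m), ∀ j, β.symm j ∈ N ↔ j ∈ N' := by
    intro N' hN'
    have e : {x // x ∈ N} ≃ {x // x ∈ N'} := Fintype.equivOfCardEq (by simp [hN'])
    refine ⟨e.extendSubtype, fun j => ⟨fun h => ?_, fun h => ?_⟩⟩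
    · have := e.extendSubtype_mem _ h
      rwa [Equiv.apply_symm_apply] at this
    · let x := e.symm ⟨j, h⟩
      have hx : e.extendSubtype x.1 = j := by
        rw [e.extendSubtype_apply_of_mem _ x.2]
        simp [x]
      rw [← hx, Equiv.symm_apply_apply]
      exact x.2
  choose! β hβ using hex
  let F : Finset (Fin m) → Fin m → ZMod 3 := fun N' j => ε₀ ((β N').symm j)
  have hmaps : ∀ N' ∈ Finset.powersetCard N.card (Finset.univ : Finset (Fin m)),
      F N' ∈ Finset.univ.filter fun ε : Fin m → ZMod 3 =>
        (⨅ i, eigenspace (ρ (γ i)) (ω ^ (ε i).val)) ≠ ⊥ := by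
    intro N' hN'
    simp only [Finset.mem_filter, Finset.mem_univ, true_and]
    exact joint_ne_bot_perm ρ γ (hP (β N')) hε₀
  have hsupp : ∀ N' ∈ Finset.powersetCard N.card (Finset.univ : Finset (Fin m)), ∀ j,
      F N' j ≠ 0 ↔ j ∈ N' := by
    intro N' hN' j
    have hc : N'.card = N.card := (Finset.mem_powersetCard.mp hN').2
    rw [← hβ N' hc j]
    simp only [F, hN, Finset.mem_filter, Finset.mem_univ, true_and]
  have hinj : Set.InjOn F ↑(Finset.powersetCard N.card (Finset.univ : Finset (Fin m))) := by
    intro N' hN' N'' hN'' h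
    ext j
    rw [← hsupp N' hN' j, ← hsupp N'' hN'' j, h]
  calc m.choose N.card = (Finset.powersetCard N.card (Finset.univ : Finset (Fin m))).card := by
        rw [Finset.card_powersetCard, Finset.card_univ, Fintype.card_fin]
    _ ≤ _ := Finset.card_le_card_of_injOn F hmaps hinj

end AltFix

end Summit.ValiantsHypothesis.ValiantsHypothesis.Theorems

end
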